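import Mathlib
import HarnessLib
import Literature.Analysis.FluidPDE.WeakSolution
import Summits.NavierStokesRegularity.NavierStokesRegularity.Theorems.ChiralWindowDoorDefs
import Summits.NavierStokesRegularity.NavierStokesRegularity.Theorems.CriticalFluxDoorDefs
import Summits.NavierStokesRegularity.NavierStokesRegularity.Theorems.RellichScarDefs
import Summits.NavierStokesRegularity.NavierStokesRegularity.Theorems.ChiralWindowDoorLocalHelicityLower
import Summits.NavierStokesRegularity.NavierStokesRegularity.Theorems.ChiralWindowDoorClassDerivDecay
import Summits.NavierStokesRegularity.NavierStokesRegularity.Theorems.ChiralWindowDoorTimeIntegratedError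
import Summits.NavierStokesRegularity.NavierStokesRegularity.Theorems.CriticalFluxDoorCritEnergySlice
import Summits.NavierStokesRegularity.NavierStokesRegularity.Theorems.CriticalFluxDoorDerivSlice
import Summits.NavierStokesRegularity.NavierStokesRegularity.Theorems.CriticalFluxDoorCritEnergyIdentity
import Summits.NavierStokesRegularity.NavierStokesRegularity.Theorems.CriticalFluxDoorAnnulusFlux
import Summits.NavierStokesRegularity.NavierStokesRegularity.Theorems.CriticalFluxDoorTimeKernels
import Summits.NavierStokesRegularity.NavierStokesRegularity.Theorems.CriticalFluxDoorCommutatorKernel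

/-!
# Door S21-C «CriticalFluxDoor» — STUB F3 `stub_critEnergyBudget` of nsreg-p1 `r20/Sketch21v3.lean`, PROVED:
# the windowed `Ḣ^{1/2}` budget `Q(a_R, v(t₀)) + 2∑ᵢ∫_{t<t₀} Q(a_R, ∂ᵢv) ≤ c` of a FLUX-FREE door-class profile

Door S21-C of nsreg-p1's local Type-I door family (`HOME/ns-regularity-ideate-p1/ROUND-20.md` §2b F3, derivation
`r20/F3-DERIVATION.md` FORM I; DESIGN-ONLY, route NOT born).  Assembly of the pieces landed by this seat:

* the identity `d/dt Q(a_R,v) = 2∫q∇a_R·Λv − 2∑ᵢ∫∂ᵢa_R⟪∂ᵢv,Λv⟫ − 2∑ᵢQ(a_R,∂ᵢv) − 2∫a_R·fluxDensity v + ∫⟪[Λ,a_R]v,∂ₜv⟫`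
  (`…CritEnergyIdentity.hasDerivAt_critEnergy_dissipation`), in which the flux term VANISHES for a flux-free profile;
* the annulus fluxes `≤ C_A R²((R+√(−t))⁴)⁻¹` (`…AnnulusFlux`), the commutator pairing `≤ c_A k_{3/4} + c_B R²(…)⁻¹ + c_C k_{1/2}`
  (`…CommutatorKernel`), whose time integrals over `(−∞,0)` are `≤ 1`, `≤ 5`, `≤ 1`, `≤ 3` uniformly in `R`
  (`…TimeIntegratedError.integral_Iio_kernel_le`, `…TimeKernels.integral_twoRegimeKernel_le`);
* `Q(a_R, v(s)) → 0` as `s → −∞` (`…CritEnergySlice`) and integrability of `t ↦ Q(a_R, ∂ᵢv(t))` (`…DerivSlice`);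
* `budget_le` — the FTC bookkeeping on `(−∞,t₀]` (as in `…ChiralWindowDoorHelicityBudget`);
* `critEnergyBudget` — **F3, text verbatim** (`c = C_A + 5c_A + c_B + 3c_C`).

With F2 = `…CritDissipationLower.critDissipationLower` this discharges both hypotheses of
`…CriticalFluxDoorTargetOfF2F3.target_of_F2_F3` (see `…CriticalFluxDoorDoor`).

Seat nsreg-p6 g13 (THEOREMS-ONLY door sequels, DIRECTOR-NS g8 #32 (2)/#36).  WHAT THIS IS NOT: not NS regularity (Clay A);
the door's windowed `Ḣ^{1/2}` budget for FLUX-FREE profiles only; no route is opened.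
-/

noncomputable section

-- the summit and its single sub-problem share the name (CONVENTIONS §1), as in every Theorems file
set_option linter.dupNamespace false

namespace Summit.NavierStokesRegularity.NavierStokesRegularity.Theorems.CriticalFluxDoorCritEnergyBudget

open MeasureTheory Metric Set Filter Topology Function
open scoped RealInnerProductSpace
open Literature.Analysis Literature.Analysis.FluidPDE
open Summit.NavierStokesRegularity.NavierStokesRegularity.Theorems.ChiralWindowDoorDefs
open Summit.NavierStokesRegularity.NavierStokesRegularity.Theorems.CriticalFluxDoorDefs
open Summit.NavierStokesRegularity.NavierStokesRegularity.Theorems.ChiralWindowDoorLocalHelicityLower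
  (contDiff_bumpSq hasCompactSupport_bumpSq)
open Summit.NavierStokesRegularity.NavierStokesRegularity.Theorems.ChiralWindowDoorClassDerivDecay
  (exists_classical_scaleInvariantBounds_of_class)
open Summit.NavierStokesRegularity.NavierStokesRegularity.Theorems.ChiralWindowDoorTimeIntegratedError
  (integral_Iio_kernel_le)
open Summit.NavierStokesRegularity.NavierStokesRegularity.Theorems.CriticalFluxDoorCritEnergySlice
  (tendsto_critEnergy_slice_atBot)
open Summit.NavierStokesRegularity.NavierStokesRegularity.Theorems.CriticalFluxDoorDerivSlice
  (integrableOn_critEnergy_pderiv)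
open Summit.NavierStokesRegularity.NavierStokesRegularity.Theorems.CriticalFluxDoorCritEnergyIdentity
  (hasDerivAt_critEnergy_dissipation)
open Summit.NavierStokesRegularity.NavierStokesRegularity.Theorems.CriticalFluxDoorAnnulusFlux
  (exists_annulusFlux_bound)
open Summit.NavierStokesRegularity.NavierStokesRegularity.Theorems.CriticalFluxDoorTimeKernels
  (twoRegimeKernel_nonneg integral_twoRegimeKernel_le)
open Summit.NavierStokesRegularity.NavierStokesRegularity.Theorems.CriticalFluxDoorCommutatorKernel
  (exists_commutatorKernel_bound)

/-! ### Bookkeeping -/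

/-- `|a| + |b| ≤ A`, `|c| ≤ B` ⟹ `|a − b + c| ≤ A + B`. -/
theorem abs_comb_le {a b c A B : ℝ} (h1 : |a| + |b| ≤ A) (h2 : |c| ≤ B) : |a - b + c| ≤ A + B := by
  have h3 := abs_add_le (a - b) c
  have h4 := abs_sub a b
  linarith

/-- **FTC bookkeeping on `(−∞, t₀]`.**  If `h' = F − 2d` on `(−∞,0)` with `|F| ≤ Φ` there, `Φ ≥ 0` integrable on
`(−∞,0)` with `∫Φ ≤ c`, `d` integrable on `(−∞,t₀]` and `h → 0` at `−∞`, then `h(t₀) + 2∫_{s<t₀} d(s) ds ≤ c`. -/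
theorem budget_le (h d F Φ : ℝ → ℝ) {t₀ c : ℝ} (ht₀ : t₀ < 0)
    (hderiv : ∀ s, s < 0 → HasDerivAt h (F s - 2 * d s) s) (hFb : ∀ s, s < 0 → |F s| ≤ Φ s)
    (hΦi : IntegrableOn Φ (Iio 0)) (hΦval : ∫ s in Iio (0 : ℝ), Φ s ≤ c) (hΦnn : ∀ s, s < 0 → 0 ≤ Φ s)
    (hdi : IntegrableOn d (Iic t₀)) (htend : Tendsto h atBot (𝓝 0)) :
    h t₀ + 2 * ∫ s in Iio t₀, d s ≤ c := by
  have hsub : Iic t₀ ⊆ Iio (0 : ℝ) := fun s hs => lt_of_le_of_lt hs ht₀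
  -- measurability of `F` on `Iic t₀`: `F = deriv h + 2 d` there
  have hFm : AEStronglyMeasurable F (volume.restrict (Iic t₀)) := by
    have hm : AEStronglyMeasurable (fun s => deriv h s + 2 * d s) (volume.restrict (Iic t₀)) :=
      (measurable_deriv h).aestronglyMeasurable.add (hdi.aestronglyMeasurable.const_mul 2)
    refine hm.congr ((ae_restrict_iff' measurableSet_Iic).2 (ae_of_all _ fun s hs => ?_))
    show deriv h s + 2 * d s = F s
    rw [(hderiv s (hsub hs)).deriv]
    ring
  have hΦi' : IntegrableOn Φ (Iic t₀) := hΦi.mono_set hsub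
  have hFi : IntegrableOn F (Iic t₀) :=
    Integrable.mono' hΦi' hFm ((ae_restrict_iff' measurableSet_Iic).2 (ae_of_all _ fun s hs => by
      rw [Real.norm_eq_abs]; exact hFb s (hsub hs)))
  -- FTC on `(−∞, t₀]`
  have hcwa : ContinuousWithinAt h (Iic t₀) t₀ := (hderiv t₀ ht₀).continuousAt.continuousWithinAt
  have hFTC := integral_Iic_of_hasDerivAt_of_tendsto hcwa (fun s hs => hderiv s ((mem_Iio.1 hs).trans ht₀))
    (hFi.sub (hdi.const_mul 2)) htend
  rw [sub_zero, integral_sub hFi (hdi.const_mul 2), integral_const_mul, integral_Iic_eq_integral_Iio (f := d)] at hFTC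
  -- `h t₀ + 2∫ d = ∫_{Iic t₀} F ≤ ∫_{Iic t₀} Φ ≤ ∫_{Iio 0} Φ ≤ c`
  have h1 : ∫ s in Iic t₀, F s ≤ ∫ s in Iic t₀, Φ s :=
    setIntegral_mono_on hFi hΦi' measurableSet_Iic fun s hs => (le_abs_self _).trans (hFb s (hsub hs))
  have h2 : ∫ s in Iic t₀, Φ s ≤ ∫ s in Iio (0 : ℝ), Φ s :=
    setIntegral_mono_set hΦi ((ae_restrict_iff' measurableSet_Iio).2 (ae_of_all _ fun s hs => hΦnn s hs))
      (ae_of_all _ hsub)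
  linarith

/-! ### F3 -/

/-- **Stub F3 `stub_critEnergyBudget` of nsreg-p1 `r20/Sketch21v3.lean` (text verbatim over the tree substrate), PROVED —
THE WINDOWED `Ḣ^{1/2}` BUDGET OF A FLUX-FREE DOOR-CLASS PROFILE.**  For a door-class profile with `fluxDensity (v t) ≡ 0`
and the weights `a_R = η(·/R)²` there is `c` (independent of `R > 0` and `t₀ < 0`) with
`Q(a_R, v(t₀)) + 2∑ᵢ∫_{t<t₀} Q(a_R, ∂ᵢv(t)) dt ≤ c`. -/
theorem critEnergyBudget : ∀ (η : EuclideanSpace ℝ (Fin 3) → ℝ), IsAdmissibleBump η → ∀ (C D : ℝ)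
    (v : ℝ → EuclideanSpace ℝ (Fin 3) → EuclideanSpace ℝ (Fin 3)),
    HasTypeITimeDecay C v → HasTypeIDecay D v →
    ContinuousOn (Function.uncurry v) (Set.Iio (0 : ℝ) ×ˢ Set.univ) →
    (∀ s t : ℝ, s < t → t < 0 → ∀ x,
        v t x = UnboundedOperators.heatExtension (v s) (t - s) x - oseenDuhamel 1 s v v t x) →
    (∀ t < 0, VectorCalculus.IsDivFree (v t)) →
    (∀ t < 0, IsFluxFree (v t)) →
    ∃ c : ℝ, ∀ R > (0 : ℝ), ∀ t₀ < (0 : ℝ),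
      critEnergy (bumpSq η R) (v t₀) + 2 * ∑ i : Fin 3, ∫ t in Set.Iio t₀, critEnergy (bumpSq η R) (pderiv i (v t)) ≤ c := by
  intro η hη C D v hrate hdecay hcont hmild hdiv hff
  -- a classical pressure with the scale-invariant package, and the flux constants
  obtain ⟨q, hsol, hSIB⟩ := exists_classical_scaleInvariantBounds_of_class hrate hdecay hcont hmild hdiv
  obtain ⟨C_A, hCA, hann⟩ := exists_annulusFlux_bound hη hsol hSIB
  obtain ⟨cA, cB, cC, hcA, hcB, hcC, hcomm⟩ := exists_commutatorKernel_bound hη hsol hSIB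
  refine ⟨C_A + cA * 5 + cB + cC * 3, fun R hR t₀ ht₀ => ?_⟩
  have ha2 : ContDiff ℝ 2 (bumpSq η R) := contDiff_bumpSq hη R
  have hac : HasCompactSupport (bumpSq η R) := hasCompactSupport_bumpSq hη hR
  -- the dissipation slices are integrable; put the sum inside the integral
  have hdI : ∀ i : Fin 3, IntegrableOn (fun t => critEnergy (bumpSq η R) (pderiv i (v t))) (Iio t₀) := fun i =>
    integrableOn_critEnergy_pderiv hη hrate hdecay hcont hmild hdiv hR ht₀ i
  have hdI' : ∀ i : Fin 3, IntegrableOn (fun t => critEnergy (bumpSq η R) (pderiv i (v t))) (Iic t₀) := fun i =>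
    (integrableOn_critEnergy_pderiv hη hrate hdecay hcont hmild hdiv hR (by linarith : t₀ / 2 < 0) i).mono_set
      fun s hs => by
        have hs' : s ≤ t₀ := hs
        show s < t₀ / 2
        linarith
  rw [← integral_finsetSum Finset.univ fun i _ => hdI i]
  -- the kernels and their time integrals
  obtain ⟨hkBi, hkBval⟩ := integral_Iio_kernel_le hR R
  obtain ⟨hk34i, hk34val⟩ := integral_twoRegimeKernel_le (α := 3 / 4) (R := R) (by norm_num) hR
  obtain ⟨hk12i, hk12val⟩ := integral_twoRegimeKernel_le (α := 1 / 2) (R := R) (by norm_num) hR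
  refine budget_le (fun s => critEnergy (bumpSq η R) (v s))
    (fun s => ∑ i : Fin 3, critEnergy (bumpSq η R) (pderiv i (v s)))
    (fun s => 2 * (∫ x, q s x * fderiv ℝ (bumpSq η R) x (fracLapHalf (v s) x))
      - 2 * (∑ i : Fin 3, ∫ x, fderiv ℝ (bumpSq η R) x (EuclideanSpace.single i 1) *
          ⟪pderiv i (v s) x, fracLapHalf (v s) x⟫)
      + ∫ x, ⟪lamComm (bumpSq η R) (v s) x, timeDeriv v s x⟫)
    (fun s => C_A * (R ^ 2 * ((R + Real.sqrt (-s)) ^ 4)⁻¹) +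
      (cA * (if -s ≤ R ^ 2 then R ^ (2 * (3 / 4 : ℝ) - 2) * (-s) ^ (-(3 / 4 : ℝ)) else R ^ 2 * (-s) ^ (-(2 : ℝ))) +
        cB * (R ^ 2 * ((R + Real.sqrt (-s)) ^ 4)⁻¹) +
        cC * (if -s ≤ R ^ 2 then R ^ (2 * (1 / 2 : ℝ) - 2) * (-s) ^ (-(1 / 2 : ℝ)) else R ^ 2 * (-s) ^ (-(2 : ℝ)))))
    ht₀ (fun s hs => ?_) (fun s hs => ?_) ?_ ?_ (fun s hs => ?_) ?_ ?_
  · -- the identity, with the flux term gone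
    have h0 : ∀ x, fluxDensity (v s) x = 0 := hff s hs
    have hT : ∫ x, bumpSq η R x * fluxDensity (v s) x = 0 := by simp only [h0, mul_zero, integral_zero]
    refine (hasDerivAt_critEnergy_dissipation hsol hSIB ha2 hac hs).congr_deriv ?_
    rw [hT]
    ring
  · -- the flux bound
    exact abs_comb_le (hann R hR s hs) (hcomm R hR s hs)
  · -- integrability of the majorant
    exact (hkBi.const_mul C_A).add (((hk34i.const_mul cA).add (hkBi.const_mul cB)).add (hk12i.const_mul cC))
  · -- its time integral
    have i1 : IntegrableOn (fun s : ℝ =>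
        cA * (if -s ≤ R ^ 2 then R ^ (2 * (3 / 4 : ℝ) - 2) * (-s) ^ (-(3 / 4 : ℝ)) else R ^ 2 * (-s) ^ (-(2 : ℝ))) +
          cB * (R ^ 2 * ((R + Real.sqrt (-s)) ^ 4)⁻¹)) (Iio 0) := (hk34i.const_mul cA).add (hkBi.const_mul cB)
    have i2 : IntegrableOn (fun s : ℝ =>
        cA * (if -s ≤ R ^ 2 then R ^ (2 * (3 / 4 : ℝ) - 2) * (-s) ^ (-(3 / 4 : ℝ)) else R ^ 2 * (-s) ^ (-(2 : ℝ))) +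
          cB * (R ^ 2 * ((R + Real.sqrt (-s)) ^ 4)⁻¹) +
          cC * (if -s ≤ R ^ 2 then R ^ (2 * (1 / 2 : ℝ) - 2) * (-s) ^ (-(1 / 2 : ℝ)) else R ^ 2 * (-s) ^ (-(2 : ℝ))))
        (Iio 0) := i1.add (hk12i.const_mul cC)
    rw [integral_add (hkBi.const_mul C_A) i2, integral_add i1 (hk12i.const_mul cC),
      integral_add (hk34i.const_mul cA) (hkBi.const_mul cB), integral_const_mul C_A, integral_const_mul cA,
      integral_const_mul cB, integral_const_mul cC]
    have hB1 : ∫ t in Iio (0 : ℝ), R ^ 2 * ((R + Real.sqrt (-t)) ^ 4)⁻¹ ≤ 1 :=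
      hkBval.trans (le_of_eq (div_self (pow_ne_zero 2 hR.ne')))
    have h34 : ∫ t in Iio (0 : ℝ),
        (if -t ≤ R ^ 2 then R ^ (2 * (3 / 4 : ℝ) - 2) * (-t) ^ (-(3 / 4 : ℝ)) else R ^ 2 * (-t) ^ (-(2 : ℝ))) ≤ 5 :=
      hk34val.trans (by norm_num)
    have h12 : ∫ t in Iio (0 : ℝ),
        (if -t ≤ R ^ 2 then R ^ (2 * (1 / 2 : ℝ) - 2) * (-t) ^ (-(1 / 2 : ℝ)) else R ^ 2 * (-t) ^ (-(2 : ℝ))) ≤ 3 :=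
      hk12val.trans (by norm_num)
    nlinarith [mul_le_mul_of_nonneg_left hB1 hCA, mul_le_mul_of_nonneg_left h34 hcA,
      mul_le_mul_of_nonneg_left hB1 hcB, mul_le_mul_of_nonneg_left h12 hcC]
  · -- non-negativity of the majorant
    have n34 := twoRegimeKernel_nonneg (3 / 4) R (-s) hR (neg_nonneg.2 hs.le)
    have n12 := twoRegimeKernel_nonneg (1 / 2) R (-s) hR (neg_nonneg.2 hs.le)
    have nB : 0 ≤ R ^ 2 * ((R + Real.sqrt (-s)) ^ 4)⁻¹ := by positivity
    exact add_nonneg (mul_nonneg hCA nB)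
      (add_nonneg (add_nonneg (mul_nonneg hcA n34) (mul_nonneg hcB nB)) (mul_nonneg hcC n12))
  · -- integrability of the dissipation on `(−∞, t₀]`
    exact integrable_finsetSum Finset.univ fun i _ => hdI' i
  · -- the boundary term at `−∞`
    exact tendsto_critEnergy_slice_atBot hη hrate hdecay hcont hmild hdiv hR

end Summit.NavierStokesRegularity.NavierStokesRegularity.Theorems.CriticalFluxDoorCritEnergyBudget

end
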